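import Literature.MathematicalPhysics.QuantumFieldTheory.Balaban1983to89.B12FaddeevPopov016

/-!
# `Balaban1983to89.B14Eq15Concrete` — CMP 119 (1.5) p. 247, the axial gauge-fixing identity of the first step, PROVED as
# printed: a product over `y ∈ P₁¹`, `x ∈ B(y) ∖ {y}` of one-variable Haar integrals each equal to `1` by r09's Faddeev–Popov
# identity (I.0.15) (`B12FaddeevPopov016.fp015_normalised`), with print's `U^u(y,x)` identified as `U(y,x)u(x)⁻¹` for the
# one-site transformation by the covariance of the contour datum

statement-level skeleton of published theorems with citation tags; proofs where landed; nothing here is a claim about the Yang–Mills mass gap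

CITATION HEADER (lean-in-tree rule).  Source: T. Bałaban, *Convergent renormalization expansions for lattice gauge
theories*, Commun. Math. Phys. **119**, 243–285 (1988), doi:10.1007/bf01217741 [Balaban1988Convergent] (cell paper
B14 = «[III]»; held `paper:balaban1988-cmp119-convergent-renormalization`, journal page = PDF page + 242; p. 247 read on
the text layer `p0005` and the x2 render `…-p005-x2.png`).  Mega-formalization `lit-balaban`, unit `lit-balaban-r11`
(CMP 119, B14 fold owner), SKELETON row **B14.Eq1.5** (B12 side: [I] (0.15)/(0.16) = row B12.Eq0.15–0.16, r09's
`…B12FaddeevPopov016`; the Faddeev–Popov PROCEDURE (1.5) ⇒ (1.6) is p28's `…B14Eq16FaddeevPopov`/`…B14Eq16Proof`, row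
B14.Eq1.6).

THE PRINTED TEXT (p. 246 bottom – p. 247 [PDF 4–5], verbatim).  *"In blocks of B(P₁¹) we introduce the axial gauge fixing
expression, the same as in (0.16) [I]:
  1 = Π_{y∈P₁¹} Π_{x∈B(y), x≠y} ∫du(x) (1/z) χ({|U^u(y,x) − 1| < ε₀}) exp[−(1/g₀²)[1 − Re tr U^u(y,x)]],   (1.5)
where U(y,x) are the variables introduced by (0.11) [I]. We insert it under the integral, and we apply the Faddeev-Popov
procedure. This yields the equality (1.6)"*; at the k-th step (p. 265): *"we introduce the axial gauge fixing as in (1.5),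
with V_k, ε_k, g_k instead of U, ε₀, g₀"*.

WHAT IS PROVED (theorems only; every object pre-existing, knitted BY NAME).  Typed at a general scale `j` (fine lattice
`T^{(j)}`, blocks `B(y)`, `y ∈ T^{(j+1)}`, so that the k-th step form of p. 265 is the same theorem): `holTo_gaugeAct_single`
— for the gauge transformation `u` equal to `g` at one site `x ≠ y` of the fine lattice and `1` elsewhere, print's
`U^u(y,x) = U(y,x)·g⁻¹` (`Setup.ContourData.covariant`); **`eq15_concrete`** — (1.5) itself: the product over `y ∈ P₁¹`,
`x ∈ B(y) ∖ {y}` of `(1/z)∫du χ({|U(y,x)u⁻¹ − 1| < ε₀}) exp[−(1/g₀²)[1 − Re tr U(y,x)u⁻¹]]` equals `1`, each factor being r09's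
normalised (I.0.15) `fp015_normalised` (`z = B16ZLower.zNorm G g₀² ε₀ ≠ 0`, `du` = `HaarData.haar`, integrand
`B12FaddeevPopov016.fpIntegrand (g₀²) ε₀`); `eq15_factor` — one factor.

NOT ASSERTED: (1.6) (row B14.Eq1.6), the alternative δ-function gauge fixing of the p. 247 remark (*"as in (9), (10) [16]"*),
`z ≠ 0` (a hypothesis; `z > 0` is r09's/pv's `B16ZLower` material).  No definitions, no `sorry`.

## References
* [Balaban1988Convergent] T. Bałaban, Commun. Math. Phys. 119 (1988) 243–285, (1.5) p. 247, p. 265.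
* [Balaban1987RG1] T. Bałaban, Commun. Math. Phys. 109 (1987) 249–301, (0.11), (0.15)–(0.16) pp. 253–255 ([I]).
-/

noncomputable section

namespace Literature.MathematicalPhysics.QuantumFieldTheory.Balaban1983to89.B14.Eq15Concrete

open _root_.MeasureTheory
open Literature.MathematicalPhysics.QuantumFieldTheory.Balaban1983to89
open B12FaddeevPopov016
open scoped BigOperators

variable {P : Params} {j : ℕ} {G : Type*} [GaugeGroup G]

/-- Print's `U^u(y,x)` for the one-site transformation: if `u = g` at the fine site `x` and `u = 1` elsewhere, and `x` is not
the block centre `y` (`emb y`), then the averaged contour variable transforms as `U^u(y,x) = U(y,x)·g⁻¹` (covariance (0.11) [I] of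
the contour datum, `Setup.ContourData.covariant`). [cite: Balaban1988Convergent, (1.5) p.247] -/
theorem holTo_gaugeAct_single [DecidableEq (Site P j)] (cd : ContourData P j G) (U : GaugeField P j G) (y : Site P (j + 1))
    {x : Site P j} (hx : x ≠ emb y) (g : G) :
    cd.holTo (GaugeField.gaugeAct (Function.update (fun _ => (1 : G)) x g) U) y x = cd.holTo U y x * g⁻¹ := by
  rw [cd.covariant, Function.update_of_ne hx.symm, Function.update_self, one_mul]

variable [MeasurableSpace G] [HaarData G] [RegularGaugeGroup G]

/-- One factor of (1.5): `(1/z)∫du(x) χ({|U(y,x)u⁻¹ − 1| < ε₀}) exp[−(1/g₀²)[1 − Re tr U(y,x)u⁻¹]] = 1` — r09's normalised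
Faddeev–Popov identity (I.0.15) at `W = U(y,x)`, `α = g₀²`. [cite: Balaban1988Convergent, (1.5) p.247] -/
theorem eq15_factor (cd : ContourData P j G) {g₀ ε₀ : ℝ} (hz : B16ZLower.zNorm G (g₀ ^ 2) ε₀ ≠ 0) (U : GaugeField P j G)
    (y : Site P (j + 1)) (x : Site P j) :
    (B16ZLower.zNorm G (g₀ ^ 2) ε₀)⁻¹ *
        ∫ u, fpIntegrand (g₀ ^ 2) ε₀ (cd.holTo U y x * u⁻¹) ∂(HaarData.haar : Measure G) = 1 :=
  (fp015_normalised hz (cd.holTo U y x)).1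

/-- **(1.5)** p. 247, PROVED as printed: `1 = Π_{y∈P₁¹} Π_{x∈B(y), x≠y} ∫du(x) (1/z) χ({|U^u(y,x) − 1| < ε₀})
exp[−(1/g₀²)[1 − Re tr U^u(y,x)]]` — the product of the one-variable integrals over the blocks `B(y) = Setup.block y` minus
their centres `emb y`, `y ∈ P₁¹`, each factor `= 1` (`eq15_factor`); `U^u(y,x) = U(y,x)u(x)⁻¹` by `holTo_gaugeAct_single`.  At
scale `j` this is also the k-th step form of p. 265 («with V_k, ε_k, g_k instead of U, ε₀, g₀»).
[cite: Balaban1988Convergent, (1.5) p.247] -/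
theorem eq15_concrete (cd : ContourData P j G) {g₀ ε₀ : ℝ} (hz : B16ZLower.zNorm G (g₀ ^ 2) ε₀ ≠ 0)
    (P11 : Finset (Site P (j + 1))) (U : GaugeField P j G) :
    ∏ y ∈ P11, ∏ x ∈ (block y).erase (emb y),
      (B16ZLower.zNorm G (g₀ ^ 2) ε₀)⁻¹ *
        ∫ u, fpIntegrand (g₀ ^ 2) ε₀ (cd.holTo U y x * u⁻¹) ∂(HaarData.haar : Measure G) = 1 :=
  Finset.prod_eq_one fun y _ => Finset.prod_eq_one fun x _ => eq15_factor cd hz U y x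

end Literature.MathematicalPhysics.QuantumFieldTheory.Balaban1983to89.B14.Eq15Concrete
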